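import Literature.MathematicalPhysics.QuantumFieldTheory.Balaban1983to89.B9Eq340DirSumReadOff

/-!
# `Balaban1983to89.B9Eq340ProbeReadOffKA` — T. Bałaban, *Propagators for lattice gauge theories in a background field*, Commun. Math. Phys. **99** (1985) 389–434
# [Balaban1985BackgroundPropagators], (3.45) p. 398 «‖ζ∇_UG′(U)∇\*_Uλ‖_β ≦ …»: the BOND PROBE member (def-Y's `holderProbesKA … parBY`) of a bond word read off a
# DIRECTION-INDEXED FAMILY of site-packed words through their NEAR SITE PROBE members (`holderProbesSN … parSY`) — brick B2′ (probe form) of the `hp45W` road, for ANY source class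

[4] = T. Bałaban, *Propagators and renormalization transformations for lattice gauge theories. II*, Commun. Math. Phys. **96** (1984) 223–250 [`Balaban1984PropagatorsII`].
statement-level skeleton of published theorems with citation tags; proofs where landed; nothing here is a claim about the Yang–Mills mass gap.

WHY THIS FILE (cell `pub-ymgap`, node N06 [B9], seat `pub-ymgap-dag-n06-c` g19; road memo `pub-ymgap-dag-n06-c/HPDGW-ROAD.md`).  The sup read-off `B9Eq340DirSumReadOff.hasMaj_bond_of_dirSumFamily`
turns a family of `𝔠`-class majorants of site-packed words `S dir ν μ` into the bond word's majorant when `T′ A (⟨x,dir⟩, ν, c, c′) = γ·Σ_μ S dir ν μ A (chart x, μ, c, c′)`; the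
certificate's `hp45W` needs the PROBE form: the KA probe family (pair probes on ADMISSIBLE bond pairs along `parBY`, transported point probes, point probes) of `T′` from the near site
probe members of the `S dir ν μ` along `parSY` plus their sup members — this lineage's `B9Eq340ProbeBridgeSNtoKA` (R4b) with the direction sum of `B9Eq340ProbeBridgeDstarSN` (R4c).
* §1 ★ `assembleK_of_dirSumRead` (the assembled slot value of `T′ A` at a bond is `γ·Σ_μ` of the assembled values of the `S`'s at the charted base point), ★ `pairProbeKA_eq_dirSum`
  (on an admissible pair the KA pair probe of `T′ A` is `γ·Σ_μ` of the SN pair probes of `S dir ν μ A`: same transporter `parBY = parSY ∘ chart`, same weight, same direction).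
* §2 ★★★ `hasMaj_probesKA_of_dirSumFamily` — from `∀ dir ν μ`: the sup member `S dir ν μ : b₁ → 𝔠^{(−1)}_{blkSK(sIK bI)}` (`C₀e^{−δd}`) and the near probe member
  `Φ_SN(parSY) β ∘ S dir ν μ : b₁ → 𝔠_P^{(β−1)}_{blkPK(sIK bI)}` (`C_b e^{−δd}`), conclude `Φ_KA(parBY) β ∘ T′ : b₁ → 𝔠_P^{(β−1)}_{blkPK bI}` with `(d+1)|γ|·(C_b + C₀ + c_bb_bC₀)·e^{−δd}`.
HONEST SCOPE.  Linear bookkeeping over landed identities; no estimate of [B9] asserted; COUNT-NEUTRAL; N06 NOT discharged; nothing continuum, nothing about the mass gap.  Cell `pub-ymgap`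
(HUMAN RULING D-0062), Track A node N06 [B9], seat `pub-ymgap-dag-n06-c` (g19), 2026-08-29; a NEW file; 0 `def`, no `sorry`, no `axiom`, no `instance`, no `notation`.
-/

noncomputable section

namespace Literature.MathematicalPhysics.QuantumFieldTheory.Balaban1983to89.B9Eq340ProbeReadOffKA

open LatticeFieldCalculus (supDist)
open B9Eq39Adjoint (R R_smul)
open B4TorusKernel.MultiPeriod (torusSupNorm torusSupNorm_nonneg)
open B9BackgroundsKLevelV1 (CfgV1)
open B6GlobalChartV1 (PV blkV1 domT boxEquiv)
open B6Geom246MultiLevelBox (blkOf)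
open B6Ineq2142KLevelV1 (β lvl)
open B6KLevelCensusIndexV1 (KIdx Adm kGeo len_eq)
open B6Geom246MultiLevelTorus (geomT torusSupNorm_neg)
open B6MultiLevelTorusOperator (one_le_of_mem)
open B6Prop22KLevelTorusCensusEta (nKT nKT_pos)
open B9Thm34Ext (toB6)
open B9GeoNormsKLevelV1 (geo9K)
open B9GeoLemma21KLevelV1 (geo9K_len_pos)
open B9Thm39ReadingCoords (coordBound39 basisBound39 abs_repr_le)
open B9CoReadingCoords (assembleK XBK blkBK)
open B9CoReadingCoordsS (XSK blkSK sIK blkV1_site GcoS DcoS)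
open Node00.OpsYSectDCoords (DvcoKH)
open B9CoReadingCoordsHolder (PK blkPK probeK probeK_inl probeK_inr_inl probeK_inr_inr wK w₀K wK_nonneg w₀K_nonneg holderProbesK)
open B9CoReadingCoordsHolderAdm (wKA wKA_of_adm holderProbesKA ΦX_KA_inl_of_adm ΦX_KA_inl_of_not_adm ΦX_KA_inr_inl ΦX_KA_inr_inr)
open B9CoReadingCoordsHolderS (wS wS_nonneg)
open B9CoReadingCoordsHolderSNear (NearS wSN wSN_of_near wSN_nonneg holderProbesSN ΦX_SN_eq)
open Node00 (SiteY FBondY IBondY CfgY SiteOpY SiteParY BondParY parSY parBY parTaxiV toKT levY etaS)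
open Node00.OpsYHolderFar (pdist)
open Node00.OpsYNablaBridge (chartY slotCopyK slotCopyK_apply DvcoKH_GcoS_apply_eq assembleK_slotCopyK)
open B9Ineq349SiteComposite (etaS_pos)
open B9Eq340TaxiTelescope (norm_R_le)
open B9Thm33G0ProbeZeroAtPinsAdm (norm_assembleK_le unitaryLike_parTaxiV w₀K_eq_len_rpow)
open B9HolderProbesKAFromGradSrc (pointProbe_le_of_sup transProbe_le_of_sup)
open B9Eq340TransporterChangeY (supDist_symm_le_torusSupNorm)
open B6HolderPairPlacementV1 (torusSupNorm_toBox_sub_le_supDist)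
open T4RelativeLadder (UnitaryLike)
open B9Thm312Whole (GeoOK)
open B9Thm312WholeClasses (cNormR cNormR_loc cNormR_isLoc)
open B9SmoothHolderClassTClosure (abs_apply_le_of_hasMaj_cNormR len_le_one)
open B11SectG (BlockNorm HasMaj)


open B9Eq340ProbeBridgeSNtoKA (wKA_eq_wSN_of_adm parSY_chartY)

variable {d ℓ : ℕ} {hd : 1 ≤ d + 1} {hL : Odd (ℓ + 1) ∧ 1 < ℓ + 1} {b₀ b₁ : ℝ}
variable {𝔸 : Type} [NormedRing 𝔸] [NormedAlgebra ℂ 𝔸] [CompleteSpace 𝔸]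
variable {κ : Type} [Fintype κ]

/-! ## §1 The assembled values and the pair probe identity under a direction-sum read-off -/

section Pointwise

variable (i : KIdx d ℓ hd hL b₀ b₁) (b : Module.Basis κ ℝ 𝔸) [FiniteDimensional ℝ 𝔸] {B : B9.Backgrounds} (cfg : B.Cfg → CfgY 𝔸 i) (U₁ : B.Cfg)
  {bI : FBondY i → IBondY i}
variable {F₁ : Type} [AddCommGroup F₁] [Module ℝ F₁]
variable {S : Fin (d + 1) → Fin (d + 1) → Fin (d + 1) → F₁ →ₗ[ℝ] (XSK κ i → ℝ)} {T' : F₁ →ₗ[ℝ] (XBK κ i → ℝ)} {γ : ℝ}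

omit [CompleteSpace 𝔸] [FiniteDimensional ℝ 𝔸] in
/-- ★ the assembled `ν`-slot value of `T′ A` at a bond is `γ·Σ_μ` of the assembled `μ`-slot values of the `S`'s at the charted base point. [cite: Balaban1985BackgroundPropagators, (3.8) p.392, bookkeeping] -/
theorem assembleK_of_dirSumRead
    (hT : ∀ (A : F₁) (x : FBondY i) (ν : Fin (d + 1)) (c c' : κ), T' A (x, ν, c, c') = γ * ∑ μ : Fin (d + 1), S x.dir ν μ A (chartY i x.src, μ, c, c'))
    (A : F₁) (x : FBondY i) (ν : Fin (d + 1)) (c' : κ) :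
    assembleK b ν c' (T' A) x = γ • ∑ μ : Fin (d + 1), assembleK b μ c' (S x.dir ν μ A) (chartY i x.src) := by
  simp only [assembleK, hT, Finset.mul_sum, Finset.sum_smul, mul_smul, Finset.smul_sum]
  exact Finset.sum_comm

omit [FiniteDimensional ℝ 𝔸] in
/-- ★ **THE PAIR PROBE IDENTITY UNDER A DIRECTION-SUM READ-OFF**: on an admissible bond pair (same direction), the KA pair probe of `T′ A` along `parBY` is `γ·Σ_μ` of the SN pair
probes of `S dir ν μ A` along `parSY` at the charted base points, slot `μ` (same transporter, same weight). [cite: Balaban1985BackgroundPropagators, (3.40) p.397 + (3.45) p.398 + (3.8) p.392] -/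
theorem pairProbeKA_eq_dirSum (hcf : |i.cf| = (nKT (toKT i) : ℝ))
    (hT : ∀ (A : F₁) (x : FBondY i) (ν : Fin (d + 1)) (c c' : κ), T' A (x, ν, c, c') = γ * ∑ μ : Fin (d + 1), S x.dir ν μ A (chartY i x.src, μ, c, c'))
    (βh : ℝ) (A : F₁) {x x' : FBondY i} (h : Adm i x x') (ν : Fin (d + 1)) (c c' : κ) :
    (holderProbesKA i b B cfg (parBY i) bI).ΦX U₁ βh (T' A) (Sum.inl ((x, x'), ν, c, c')) =
      γ * ∑ μ : Fin (d + 1), (holderProbesSN i b B cfg (parSY i) bI).ΦX U₁ βh (S x.dir ν μ A)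
        (Sum.inl ((chartY i x.src, chartY i x'.src), μ, c, c')) := by
  rw [ΦX_KA_inl_of_adm i b B cfg (parBY i) U₁ βh _ h ν c c',
    show (holderProbesK i b B cfg (parBY i) bI).ΦX U₁ βh = probeK b (fun x x' : FBondY i => parBY i (cfg U₁) x.src x'.src) (wK i βh) (w₀K i βh) from rfl,
    probeK_inl]
  simp only [ΦX_SN_eq, probeK_inl]
  rw [assembleK_of_dirSumRead i b hT, assembleK_of_dirSumRead i b hT, ← h.1, R_smul, parSY_chartY, ← wKA_of_adm i βh h, wKA_eq_wSN_of_adm i hcf βh h]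
  -- `R(g)` of a finite sum, the coordinate of a scalar multiple of a sum
  have hR : ∀ (g : 𝔸ˣ) (X : Fin (d + 1) → 𝔸), R g (∑ μ : Fin (d + 1), X μ) = ∑ μ : Fin (d + 1), R g (X μ) := fun g X => by
    simp only [B9Eq39Adjoint.R_def, Finset.mul_sum, Finset.sum_mul]
  rw [hR, ← smul_sub, ← Finset.sum_sub_distrib, map_smul, map_sum, Finsupp.smul_apply, Finsupp.coe_finsetSum, Finset.sum_apply, smul_eq_mul,
    Finset.mul_sum, Finset.mul_sum, Finset.mul_sum]
  refine Finset.sum_congr rfl fun μ _ => ?_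
  ring

end Pointwise

/-! ## §2 ★★★ The bond probe member of a direction-sum read-off from the near site probe members and the sup members -/

section Package

variable (i : KIdx d ℓ hd hL b₀ b₁) (b : Module.Basis κ ℝ 𝔸) [FiniteDimensional ℝ 𝔸] [Fintype (geo9K i).Site]
variable {B : B9.Backgrounds} (cfg : B.Cfg → CfgY 𝔸 i) (U₁ : B.Cfg) {bI : FBondY i → IBondY i}
variable {R₀ : ℝ} {H₀ : Prop}
variable {F₁ : Type} [AddCommGroup F₁] [Module ℝ F₁]

/-- the sharp-block sup of `f` at `y` is below any `M ≥ 0` bounding `|f|` on the block. [folklore] -/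
private theorem ofBlocks_loc_le_of_forall {X : Type} [Fintype X] (blk : X → IBondY i) {y : IBondY i}
    {f : X → ℝ} {M : ℝ} (hM : 0 ≤ M) (h : ∀ x, blk x = y → |f x| ≤ M) : (BlockNorm.ofBlocks (toB6 (geo9K i) R₀ H₀) blk).loc y f ≤ M := by
  classical
  show (⨆ x : X, @ite ℝ (blk x = y) (Classical.propDecidable _) |f x| 0) ≤ M
  refine Real.iSup_le (fun x => ?_) hM
  split_ifs with hx
  · exact h x hx
  · exact hM

/-- ★★★ **THE BOND PROBE READ-OFF OF A DIRECTION-INDEXED FAMILY.**  For ANY source class `b₁`, unitary-like bond variables, a direction-blind level-faithful `bI`, print's units and a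
bond word `T′` with `T′ A (⟨x,dir⟩, ν, c, c′) = γ·Σ_μ S dir ν μ A (chart x, μ, c, c′)`: if every `S dir ν μ` is bounded `b₁ → 𝔠^{(−1)}_{blkSK(sIK bI)}` by `C₀e^{−δd}` ((3.42)₃-type) and
every `Φ_SN(parSY)_β ∘ S dir ν μ` is bounded `b₁ → 𝔠_P^{(β−1)}_{blkPK(sIK bI)}` by `C_b e^{−δd}` ((3.45)-type on sites), then `Φ_KA(parBY)_β ∘ T′` is bounded `b₁ → 𝔠_P^{(β−1)}_{blkPK bI}` by
`(d+1)|γ|·(C_b + C₀ + c_bb_bC₀)·e^{−δd}`.  Pair probes: `0` off `Adm`; on `Adm` §1's identity and the `d + 1` site pair members at the same anchor; (transported) point probes: the bond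
values `|T′A(q)| ≤ (d+1)|γ|C₀·len·e^{−δd}·M` and dag-n06-l's `pointProbe_le_of_sup ∕ transProbe_le_of_sup`.
[cite: Balaban1985BackgroundPropagators, (3.8) p.392 + (3.40) p.397 + (3.42), (3.45) pp.397–398; Balaban1984PropagatorsII, (2.51)–(2.52) p.232, (2.137) p.247] -/
theorem hasMaj_probesKA_of_dirSumFamily [NormOneClass 𝔸] (hG : GeoOK (geo9K i)) (hU : ∀ μ s, UnitaryLike (cfg U₁ μ s))
    (hlev : ∀ x : FBondY i, lvl i.hN i.D i.hk (bI x) = (blkV1 i.hN i.D x).1.1) (hbI0 : ∀ x : FBondY i, bI x = bI ⟨x.src, 0⟩)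
    (hcf : |i.cf| = (nKT (toKT i) : ℝ))
    {b₁ : BlockNorm (toB6 (geo9K i) R₀ H₀) F₁} (S : Fin (d + 1) → Fin (d + 1) → Fin (d + 1) → F₁ →ₗ[ℝ] (XSK κ i → ℝ))
    {T' : F₁ →ₗ[ℝ] (XBK κ i → ℝ)} {γ : ℝ}
    (hT : ∀ (A : F₁) (x : FBondY i) (ν : Fin (d + 1)) (c c' : κ),
      T' A (x, ν, c, c') = γ * ∑ μ : Fin (d + 1), S x.dir ν μ A (chartY i x.src, μ, c, c'))
    {βh : ℝ} {C₀ Cb δ : ℝ} (hC₀ : 0 ≤ C₀) (hCb : 0 ≤ Cb)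
    (hsup : ∀ dir ν μ : Fin (d + 1), HasMaj b₁ (cNormR R₀ H₀ (blkSK i (sIK i bI)) hG.lenle (-1)) (S dir ν μ)
      (fun a a' => C₀ * Real.exp (-(δ * (geo9K i).dist a a'))))
    (hpr : ∀ dir ν μ : Fin (d + 1), HasMaj b₁ (cNormR R₀ H₀ (blkPK (sIK i bI)) hG.lenle (βh - 1))
      ((holderProbesSN i b B cfg (parSY i) bI).ΦX U₁ βh ∘ₗ S dir ν μ) (fun a a' => Cb * Real.exp (-(δ * (geo9K i).dist a a')))) :
    HasMaj b₁ (cNormR R₀ H₀ (blkPK bI) hG.lenle (βh - 1)) ((holderProbesKA i b B cfg (parBY i) bI).ΦX U₁ βh ∘ₗ T')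
      (fun a a' => ((d + 1 : ℕ) : ℝ) * |γ| * (Cb + C₀ + coordBound39 b * basisBound39 b * C₀) * Real.exp (-(δ * (geo9K i).dist a a'))) := by
  classical
  set D1 : ℝ := ((d + 1 : ℕ) : ℝ) with hD1
  have hD0 : 0 ≤ D1 := by rw [hD1]; positivity
  have hγ0 : 0 ≤ |γ| := abs_nonneg _
  have hcB : 0 ≤ coordBound39 b := by unfold coordBound39; exact norm_nonneg _
  have hbB : 0 ≤ basisBound39 b := Finset.sum_nonneg fun _ _ => norm_nonneg _
  set Ctot : ℝ := D1 * |γ| * (Cb + C₀ + coordBound39 b * basisBound39 b * C₀) with hCtot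
  have hCtot0 : 0 ≤ Ctot := by rw [hCtot]; positivity
  intro y' A hA y
  set M : ℝ := b₁.loc y' A with hMdef
  have hM : 0 ≤ M := b₁.loc_nonneg _ _
  -- the site anchor of a bond's base point IS the bond's block (direction-blind `bI`)
  have hanchor : ∀ x : FBondY i, sIK i bI (chartY i x.src) = bI x := by
    intro x
    show bI ⟨(boxEquiv i.hN).symm (boxEquiv i.hN x.src), 0⟩ = bI x
    rw [Equiv.symm_apply_apply, ← hbI0 x]
  -- the bond values of `T′ A` from the sup members of the family
  set G : XBK κ i → ℝ := T' A with hGdef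
  have hF0 : ∀ q : XBK κ i, |G q| ≤ D1 * |γ| * C₀ * (geo9K i).len (bI q.1) * Real.exp (-(δ * (geo9K i).dist (bI q.1) y')) * M := by
    rintro ⟨x, ν, c, c'⟩
    rw [hGdef, hT, abs_mul]
    have hl : 0 < (geo9K i).len (bI x) := geo9K_len_pos i _
    have hterm : ∀ μ : Fin (d + 1), |S x.dir ν μ A (chartY i x.src, μ, c, c')| ≤
        (geo9K i).len (bI x) * (C₀ * Real.exp (-(δ * (geo9K i).dist (bI x) y'))) * M := by
      intro μ
      have hv := abs_apply_le_of_hasMaj_cNormR i hG.lenle (hsup x.dir ν μ) hA (chartY i x.src, μ, c, c')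
      have hl' : 0 < (geo9K i).len (sIK i bI (chartY i x.src)) := geo9K_len_pos i _
      rw [show blkSK i (sIK i bI) (chartY i x.src, μ, c, c') = sIK i bI (chartY i x.src) from rfl, Real.rpow_neg hl'.le, inv_inv, Real.rpow_one,
        hanchor x] at hv
      exact hv
    calc |γ| * |∑ μ : Fin (d + 1), S x.dir ν μ A (chartY i x.src, μ, c, c')|
        ≤ |γ| * ∑ μ : Fin (d + 1), |S x.dir ν μ A (chartY i x.src, μ, c, c')| := mul_le_mul_of_nonneg_left (Finset.abs_sum_le_sum_abs _ _) hγ0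
      _ ≤ |γ| * ∑ _μ : Fin (d + 1), (geo9K i).len (bI x) * (C₀ * Real.exp (-(δ * (geo9K i).dist (bI x) y'))) * M :=
          mul_le_mul_of_nonneg_left (Finset.sum_le_sum fun μ _ => hterm μ) hγ0
      _ = D1 * |γ| * C₀ * (geo9K i).len (bI x) * Real.exp (-(δ * (geo9K i).dist (bI x) y')) * M := by
          rw [Finset.sum_const, Finset.card_univ, Fintype.card_fin, nsmul_eq_mul, hD1]; ring
  -- every probe anchored at `y` is `≤ Ctot·len(y)^{1−β}·e^{−δ d(y,y′)}·M`
  have hpt : ∀ idx : PK (FBondY i) (Fin (d + 1)) κ, blkPK bI idx = y →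
      |(holderProbesKA i b B cfg (parBY i) bI).ΦX U₁ βh G idx| ≤
        Ctot * (geo9K i).len y ^ (1 - βh) * Real.exp (-(δ * (geo9K i).dist y y')) * M := by
    intro idx hidx
    have hup : ∀ {C a : ℝ} (z : IBondY i), C ≤ Ctot →
        a ≤ C * (geo9K i).len z ^ (1 - βh) * Real.exp (-(δ * (geo9K i).dist z y')) * M →
        a ≤ Ctot * (geo9K i).len z ^ (1 - βh) * Real.exp (-(δ * (geo9K i).dist z y')) * M := by
      intro C a z hCle h
      refine h.trans ?_
      have hl : 0 ≤ (geo9K i).len z ^ (1 - βh) := Real.rpow_nonneg (le_of_lt (geo9K_len_pos i z)) _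
      have hE := Real.exp_nonneg (-(δ * (geo9K i).dist z y'))
      exact mul_le_mul_of_nonneg_right (mul_le_mul_of_nonneg_right (mul_le_mul_of_nonneg_right hCle hl) hE) hM
    rcases idx with ⟨⟨x, x'⟩, ν, c, c'⟩ | ⟨⟨x, x'⟩, ν, c, c'⟩ | ⟨x, ν, c, c'⟩
    · have hx : bI x = y := hidx
      subst hx
      by_cases hadm : Adm i x x'
      · -- the pair probe identity + the `d + 1` site pair members at the anchor `bI x`
        rw [hGdef, pairProbeKA_eq_dirSum i b cfg U₁ hcf hT βh A hadm ν c c', abs_mul]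
        have hl : 0 < (geo9K i).len (bI x) := geo9K_len_pos i _
        have e : ((geo9K i).len (bI x) ^ (βh - 1))⁻¹ = (geo9K i).len (bI x) ^ (1 - βh) := by
          rw [← Real.rpow_neg hl.le, neg_sub]
        have hterm : ∀ μ : Fin (d + 1), |(holderProbesSN i b B cfg (parSY i) bI).ΦX U₁ βh (S x.dir ν μ A)
            (Sum.inl ((chartY i x.src, chartY i x'.src), μ, c, c'))| ≤ (geo9K i).len (bI x) ^ (1 - βh) * (Cb * Real.exp (-(δ * (geo9K i).dist (bI x) y'))) * M := by
          intro μ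
          have hv := abs_apply_le_of_hasMaj_cNormR i hG.lenle (hpr x.dir ν μ) hA (Sum.inl ((chartY i x.src, chartY i x'.src), μ, c, c'))
          rw [LinearMap.comp_apply,
            show blkPK (I := (geo9K i).Site) (sIK i bI) (Sum.inl ((chartY i x.src, chartY i x'.src), μ, c, c') : PK (SiteY i) (Fin (d + 1)) κ) = bI x
              from hanchor x, e] at hv
          exact hv
        have h1 : |γ| * |∑ μ : Fin (d + 1), (holderProbesSN i b B cfg (parSY i) bI).ΦX U₁ βh (S x.dir ν μ A)
              (Sum.inl ((chartY i x.src, chartY i x'.src), μ, c, c'))| ≤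
            D1 * |γ| * Cb * (geo9K i).len (bI x) ^ (1 - βh) * Real.exp (-(δ * (geo9K i).dist (bI x) y')) * M := by
          calc _ ≤ |γ| * ∑ μ : Fin (d + 1), |(holderProbesSN i b B cfg (parSY i) bI).ΦX U₁ βh (S x.dir ν μ A)
                (Sum.inl ((chartY i x.src, chartY i x'.src), μ, c, c'))| := mul_le_mul_of_nonneg_left (Finset.abs_sum_le_sum_abs _ _) hγ0
            _ ≤ |γ| * ∑ _μ : Fin (d + 1), (geo9K i).len (bI x) ^ (1 - βh) * (Cb * Real.exp (-(δ * (geo9K i).dist (bI x) y'))) * M :=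
                mul_le_mul_of_nonneg_left (Finset.sum_le_sum fun μ _ => hterm μ) hγ0
            _ = D1 * |γ| * Cb * (geo9K i).len (bI x) ^ (1 - βh) * Real.exp (-(δ * (geo9K i).dist (bI x) y')) * M := by
                rw [Finset.sum_const, Finset.card_univ, Fintype.card_fin, nsmul_eq_mul, hD1]; ring
        exact hup (C := D1 * |γ| * Cb) (bI x)
          (by rw [hCtot]; nlinarith [mul_nonneg (mul_nonneg hD0 hγ0) hC₀, mul_nonneg (mul_nonneg hD0 hγ0) (mul_nonneg (mul_nonneg hcB hbB) hC₀)]) h1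
      · rw [ΦX_KA_inl_of_not_adm i b B cfg (parBY i) U₁ βh G hadm ν c c', abs_zero]
        have hl : 0 ≤ (geo9K i).len (bI x) ^ (1 - βh) := Real.rpow_nonneg (le_of_lt (geo9K_len_pos i (bI x))) _
        have hE := Real.exp_nonneg (-(δ * (geo9K i).dist (bI x) y'))
        positivity
    · have hx : bI x' = y := hidx
      subst hx
      rw [ΦX_KA_inr_inl]
      have h := transProbe_le_of_sup i b cfg U₁ (par := parBY i) rfl hU hlev G (C₀ := D1 * |γ| * C₀) hF0 βh x x' ν c c'
      exact hup (C := coordBound39 b * basisBound39 b * (D1 * |γ| * C₀)) (bI x')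
        (by rw [hCtot]; nlinarith [mul_nonneg (mul_nonneg hD0 hγ0) hC₀, mul_nonneg (mul_nonneg hD0 hγ0) hCb]) h
    · have hx : bI x = y := hidx
      subst hx
      rw [ΦX_KA_inr_inr]
      exact hup (C := D1 * |γ| * C₀) (bI x)
        (by rw [hCtot]; nlinarith [mul_nonneg (mul_nonneg hD0 hγ0) hCb, mul_nonneg (mul_nonneg hD0 hγ0) (mul_nonneg (mul_nonneg hcB hbB) hC₀)])
        (pointProbe_le_of_sup i b cfg U₁ (parBY i) hlev G hF0 βh x ν c c')
  -- assemble the `𝔠_P^{(β−1)}` size at `y`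
  have hlen0 : 0 < (geo9K i).len y := geo9K_len_pos i y
  have hloc : (BlockNorm.ofBlocks (toB6 (geo9K i) R₀ H₀) (blkPK bI)).loc y (((holderProbesKA i b B cfg (parBY i) bI).ΦX U₁ βh ∘ₗ T') A) ≤
      Ctot * (geo9K i).len y ^ (1 - βh) * Real.exp (-(δ * (geo9K i).dist y y')) * M :=
    ofBlocks_loc_le_of_forall i (blkPK bI) (by positivity) hpt
  show (cNormR R₀ H₀ (blkPK bI) hG.lenle (βh - 1)).loc y (((holderProbesKA i b B cfg (parBY i) bI).ΦX U₁ βh ∘ₗ T') A) ≤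
    D1 * |γ| * (Cb + C₀ + coordBound39 b * basisBound39 b * C₀) * Real.exp (-(δ * (geo9K i).dist y y')) * M
  rw [cNormR_loc, ← hCtot]
  calc (geo9K i).len y ^ (βh - 1) * (BlockNorm.ofBlocks (toB6 (geo9K i) R₀ H₀) (blkPK bI)).loc y (((holderProbesKA i b B cfg (parBY i) bI).ΦX U₁ βh ∘ₗ T') A)
      ≤ (geo9K i).len y ^ (βh - 1) * (Ctot * (geo9K i).len y ^ (1 - βh) * Real.exp (-(δ * (geo9K i).dist y y')) * M) :=
        mul_le_mul_of_nonneg_left hloc (Real.rpow_nonneg hlen0.le _)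
    _ = Ctot * ((geo9K i).len y ^ (βh - 1) * (geo9K i).len y ^ (1 - βh)) * Real.exp (-(δ * (geo9K i).dist y y')) * M := by ring
    _ = Ctot * Real.exp (-(δ * (geo9K i).dist y y')) * M := by
        rw [← Real.rpow_add hlen0, show βh - 1 + (1 - βh) = 0 by ring, Real.rpow_zero, mul_one]

end Package

end Literature.MathematicalPhysics.QuantumFieldTheory.Balaban1983to89.B9Eq340ProbeReadOffKA

end
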